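import Mathlib
import HarnessLib

/-!
# ζ(5) search — PERIODIC CELL KIT I: integer-affine forms and kernel-checkable Farkas certificates (fam-denom g14)

HONEST FRAMING: systematic search; no irrationality claim unless certified.  Cell `pub-zeta5`, family-designer seat
fam-denom, generation 14.  Pure integer linear algebra in four variables; nothing about ζ(5) is asserted here.

Every `omega` obligation in a periodic ray-C1 cell file (`RayC1PeriodicC…`) is an implication between integer-affine
inequalities in the slot coordinates `(x, n, p, P)` (`P = t·p`).  This file provides the data type `LinForm` of such
forms, the two sound INTEGER refinements used by the table checker — the parity substitution `n = 2n' + a, p = 2p' + 1`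
(`psub`) and gcd-tightening of a hypothesis / gcd-relaxation of a conclusion (`gtight`, `grelax`) — and the FARKAS CHECK
`farkasCheck`: given four hypothesis forms, a table-supplied integer matrix produces candidate multipliers `λ`, and the
kernel VERIFIES the identity `d·∇f = Σ λᵢ ∇hᵢ`, `λᵢ ≥ 0`, `Σ λᵢ cᵢ ≤ d·c_f`, `d > 0`; soundness (`farkasCheck_sound`) is
"a nonnegative combination of nonnegatives is nonnegative" — how `λ` was found is irrelevant.  `oblOK` tries the (≤ 4)
bases of a slot.  Consumers: `PeriodicCellKit` (slot typing and covers from table rows).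
-/

namespace Summit.KontsevichZagierPeriods.Zeta5Search.CellKit

/-- An integer-affine form `cx·x + cn·n + cp·p + cP·P + c0` in the four slot coordinates. -/
structure LinForm where
  /-- coefficient of the residue `x` -/
  cx : ℤ
  /-- coefficient of `n` -/
  cn : ℤ
  /-- coefficient of the prime `p` -/
  cp : ℤ
  /-- coefficient of `P = t·p` -/
  cP : ℤ
  /-- constant -/
  c0 : ℤ
deriving DecidableEq, Repr

namespace LinForm

/-- Value of a form at integer coordinates. -/
def eval (f : LinForm) (x n p P : ℤ) : ℤ := f.cx * x + f.cn * n + f.cp * p + f.cP * P + f.c0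

/-- The zero form (a harmless default hypothesis). -/
def zero : LinForm := ⟨0, 0, 0, 0, 0⟩

/-- The zero form evaluates to `0`. -/
@[simp] theorem eval_zero (x n p P : ℤ) : zero.eval x n p P = 0 := by simp [eval, zero]

/-- PARITY SUBSTITUTION `n = 2n' + a`, `p = 2p' + 1`: the same form in the coordinates `(x, n', p', P)`. -/
def psub (a : ℤ) (f : LinForm) : LinForm := ⟨f.cx, 2 * f.cn, 2 * f.cp, f.cP, f.c0 + a * f.cn + f.cp⟩

/-- `psub` is the substitution it claims to be. -/
theorem eval_psub (a : ℤ) (f : LinForm) (x n' p' P : ℤ) :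
    (f.psub a).eval x n' p' P = f.eval x (2 * n' + a) (2 * p' + 1) P := by
  simp only [eval, psub]; ring

/-- The gcd of the four variable coefficients (as an integer; `0` if all vanish). -/
def vgcd (f : LinForm) : ℤ := (Int.gcd (Int.gcd (Int.gcd f.cx f.cn) f.cp) f.cP : ℤ)

/-- `vgcd f` divides the variable part of `f`. -/
theorem vgcd_dvd (f : LinForm) (x n p P : ℤ) : f.vgcd ∣ f.cx * x + f.cn * n + f.cp * p + f.cP * P := by
  unfold vgcd
  have h1 : ((Int.gcd (Int.gcd (Int.gcd f.cx f.cn) f.cp) f.cP : ℕ) : ℤ) ∣ (Int.gcd (Int.gcd f.cx f.cn) f.cp : ℤ) :=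
    Int.gcd_dvd_left _ _
  have h2 : ((Int.gcd (Int.gcd f.cx f.cn) f.cp : ℕ) : ℤ) ∣ (Int.gcd f.cx f.cn : ℤ) := Int.gcd_dvd_left _ _
  have hx : f.vgcd ∣ f.cx := (h1.trans h2).trans (Int.gcd_dvd_left _ _)
  have hn : f.vgcd ∣ f.cn := (h1.trans h2).trans (Int.gcd_dvd_right _ _)
  have hp : f.vgcd ∣ f.cp := h1.trans (Int.gcd_dvd_right _ _)
  have hP : f.vgcd ∣ f.cP := Int.gcd_dvd_right _ _
  exact dvd_add (dvd_add (dvd_add (dvd_mul_of_dvd_left hx x) (dvd_mul_of_dvd_left hn n)) (dvd_mul_of_dvd_left hp p))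
    (dvd_mul_of_dvd_left hP P)

/-- GCD-TIGHTENING of a hypothesis `f ≥ 0`: the constant may be lowered to the next multiple-compatible value. -/
def gtight (f : LinForm) : LinForm := if f.vgcd ≤ 1 then f else { f with c0 := f.c0 - f.c0 % f.vgcd }

/-- `gtight` is sound on integer points: `0 ≤ f ⇒ 0 ≤ gtight f`. -/
theorem eval_gtight_nonneg {f : LinForm} {x n p P : ℤ} (h : 0 ≤ f.eval x n p P) : 0 ≤ (gtight f).eval x n p P := by
  unfold gtight
  split_ifs with hg
  · exact h
  · obtain ⟨q, hq⟩ := f.vgcd_dvd x n p P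
    set g := f.vgcd with hgdef
    have hg0 : 0 < g := by omega
    simp only [eval] at h ⊢
    rw [hq] at h ⊢
    have hc : g * (f.c0 / g) + f.c0 % g = f.c0 := Int.mul_ediv_add_emod f.c0 g
    have hr : f.c0 % g < g := Int.emod_lt_of_pos _ hg0
    have hq0 : 0 ≤ q + f.c0 / g := by
      by_contra hc'
      have : g * (q + f.c0 / g) ≤ g * (-1) := Int.mul_le_mul_of_nonneg_left (by omega) hg0.le
      nlinarith
    have : g * q + (f.c0 - f.c0 % g) = g * (q + f.c0 / g) := by rw [mul_add]; omega
    rw [this]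
    exact mul_nonneg hg0.le hq0

/-- GCD-RELAXATION of a conclusion `f ≥ 0`: it suffices to prove the form with the constant raised by `g - 1 - c0 mod g`. -/
def grelax (f : LinForm) : LinForm := if f.vgcd ≤ 1 then f else { f with c0 := f.c0 + (f.vgcd - 1 - f.c0 % f.vgcd) }

/-- `grelax` is sound on integer points: `0 ≤ grelax f ⇒ 0 ≤ f`. -/
theorem eval_nonneg_of_grelax {f : LinForm} {x n p P : ℤ} (h : 0 ≤ (grelax f).eval x n p P) : 0 ≤ f.eval x n p P := by
  unfold grelax at h
  split_ifs at h with hg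
  · exact h
  · obtain ⟨q, hq⟩ := f.vgcd_dvd x n p P
    set g := f.vgcd with hgdef
    have hg0 : 0 < g := by omega
    simp only [eval] at h ⊢
    rw [hq] at h ⊢
    have hc : g * (f.c0 / g) + f.c0 % g = f.c0 := Int.mul_ediv_add_emod f.c0 g
    have hr0 : 0 ≤ f.c0 % g := Int.emod_nonneg _ (by omega)
    have hq0 : 0 ≤ q + f.c0 / g := by
      by_contra hc'
      have : g * (q + f.c0 / g) ≤ g * (-1) := Int.mul_le_mul_of_nonneg_left (by omega) hg0.le
      nlinarith
    have e : g * q + f.c0 = g * (q + f.c0 / g) + f.c0 % g := by rw [mul_add]; omega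
    rw [e]
    exact add_nonneg (mul_nonneg hg0.le hq0) hr0

end LinForm

/-- A FARKAS BASIS of a slot: four hypothesis indices and an integer matrix `m` (16 entries, row-major) with a positive
scale `d`; the candidate multipliers of a conclusion `f` are `λ = m · ∇f`.  (The table generator puts `m = d·A_B⁻ᵀ`;
the kernel does not care — it verifies the resulting identity.) -/
structure Basis where
  /-- hypothesis indices -/
  i1 : ℕ
  /-- hypothesis indices -/
  i2 : ℕ
  /-- hypothesis indices -/
  i3 : ℕ
  /-- hypothesis indices -/
  i4 : ℕ
  /-- multiplier matrix, 16 entries row-major -/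
  m : List ℤ
  /-- positive scale -/
  d : ℤ
deriving DecidableEq, Repr

namespace Basis

/-- Row `i` of the multiplier matrix applied to `∇f`. -/
def lam (b : Basis) (f : LinForm) (i : ℕ) : ℤ :=
  b.m.getD (4 * i) 0 * f.cx + b.m.getD (4 * i + 1) 0 * f.cn + b.m.getD (4 * i + 2) 0 * f.cp + b.m.getD (4 * i + 3) 0 * f.cP

end Basis


/-! ## Farkas bases computed in the kernel from four hypothesis indices (cofactor formula; correctness is NOT needed —
`farkasCheck` verifies whatever multipliers result) -/

namespace LinForm

/-- Coordinate `c` of the gradient (`0,1,2,3 ↦ cx,cn,cp,cP`). -/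
def g (f : LinForm) (c : ℕ) : ℤ :=
  match c with
  | 0 => f.cx
  | 1 => f.cn
  | 2 => f.cp
  | _ => f.cP

end LinForm

/-- A `3 × 3` determinant. -/
def det3 (a b c d e f g h i : ℤ) : ℤ := a * (e * i - f * h) - b * (d * i - f * g) + c * (d * h - e * g)

/-- The three indices of `{0,1,2,3}` other than `i`. -/
def others (i : ℕ) : ℕ × ℕ × ℕ :=
  match i with
  | 0 => (1, 2, 3)
  | 1 => (0, 2, 3)
  | 2 => (0, 1, 3)
  | _ => (0, 1, 2)

/-- Cofactor `(i, c)` of the `4 × 4` gradient matrix `A` (rows = hypothesis gradients). -/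
def cof (A : ℕ → ℕ → ℤ) (i c : ℕ) : ℤ :=
  let r := others i
  let s := others c
  (if (i + c) % 2 = 0 then 1 else -1) *
    det3 (A r.1 s.1) (A r.1 s.2.1) (A r.1 s.2.2) (A r.2.1 s.1) (A r.2.1 s.2.1) (A r.2.1 s.2.2)
      (A r.2.2 s.1) (A r.2.2 s.2.1) (A r.2.2 s.2.2)

/-- **Basis from indices**: multiplier matrix `sign(det A) · cof(A)` and scale `|det A|`, so that `λ = M ∇f` solves
`Aᵀ λ = |det A| ∇f` whenever `A` is invertible (and fails verification harmlessly otherwise). -/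
def mkBasis (H : List LinForm) (q : ℕ × ℕ × ℕ × ℕ) : Basis :=
  let A : ℕ → ℕ → ℤ := fun i c =>
    (H.getD (match i with | 0 => q.1 | 1 => q.2.1 | 2 => q.2.2.1 | _ => q.2.2.2) LinForm.zero).g c
  let dt := A 0 0 * cof A 0 0 + A 0 1 * cof A 0 1 + A 0 2 * cof A 0 2 + A 0 3 * cof A 0 3
  let sg : ℤ := if dt < 0 then -1 else 1
  ⟨q.1, q.2.1, q.2.2.1, q.2.2.2,
    [sg * cof A 0 0, sg * cof A 0 1, sg * cof A 0 2, sg * cof A 0 3, sg * cof A 1 0, sg * cof A 1 1, sg * cof A 1 2, sg * cof A 1 3,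
     sg * cof A 2 0, sg * cof A 2 1, sg * cof A 2 2, sg * cof A 2 3, sg * cof A 3 0, sg * cof A 3 1, sg * cof A 3 2, sg * cof A 3 3],
    (dt.natAbs : ℤ)⟩

open LinForm in
/-- **The Farkas check.** With `hⱼ := H[iⱼ]` (zero form if out of range) and `λⱼ := (m ∇f)ⱼ`: `d > 0`, `λⱼ ≥ 0`,
`d·∇f = Σ λⱼ ∇hⱼ` coordinatewise, and `Σ λⱼ c(hⱼ) ≤ d·c(f)`. -/
def farkasCheck (H : List LinForm) (b : Basis) (f : LinForm) : Bool :=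
  let h1 := H.getD b.i1 LinForm.zero
  let h2 := H.getD b.i2 LinForm.zero
  let h3 := H.getD b.i3 LinForm.zero
  let h4 := H.getD b.i4 LinForm.zero
  let l1 := b.lam f 0
  let l2 := b.lam f 1
  let l3 := b.lam f 2
  let l4 := b.lam f 3
  decide (0 < b.d) && decide (0 ≤ l1) && decide (0 ≤ l2) && decide (0 ≤ l3) && decide (0 ≤ l4) &&
  decide (b.d * f.cx = l1 * h1.cx + l2 * h2.cx + l3 * h3.cx + l4 * h4.cx) &&
  decide (b.d * f.cn = l1 * h1.cn + l2 * h2.cn + l3 * h3.cn + l4 * h4.cn) &&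
  decide (b.d * f.cp = l1 * h1.cp + l2 * h2.cp + l3 * h3.cp + l4 * h4.cp) &&
  decide (b.d * f.cP = l1 * h1.cP + l2 * h2.cP + l3 * h3.cP + l4 * h4.cP) &&
  decide (l1 * h1.c0 + l2 * h2.c0 + l3 * h3.c0 + l4 * h4.c0 ≤ b.d * f.c0)

/-- A default-indexed hypothesis is nonnegative. -/
theorem holds_getD {H : List LinForm} {x n p P : ℤ} (hH : ∀ h ∈ H, 0 ≤ h.eval x n p P) (i : ℕ) :
    0 ≤ (H.getD i LinForm.zero).eval x n p P := by
  rw [List.getD_eq_getElem?_getD]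
  cases h : H[i]? with
  | none => simp
  | some g => simpa using hH g (List.mem_of_getElem? h)

/-- **Soundness of the Farkas check**: a verified nonnegative combination of nonnegative hypotheses. -/
theorem farkasCheck_sound {H : List LinForm} {b : Basis} {f : LinForm} (hc : farkasCheck H b f = true)
    {x n p P : ℤ} (hH : ∀ h ∈ H, 0 ≤ h.eval x n p P) : 0 ≤ f.eval x n p P := by
  unfold farkasCheck at hc
  simp only [Bool.and_eq_true, decide_eq_true_eq] at hc
  obtain ⟨⟨⟨⟨⟨⟨⟨⟨⟨hd, l1⟩, l2⟩, l3⟩, l4⟩, ex⟩, en⟩, ep⟩, eP⟩, e0⟩ := hc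
  have g1 := holds_getD hH b.i1
  have g2 := holds_getD hH b.i2
  have g3 := holds_getD hH b.i3
  have g4 := holds_getD hH b.i4
  simp only [LinForm.eval] at g1 g2 g3 g4 ⊢
  have key : b.d * (f.cx * x + f.cn * n + f.cp * p + f.cP * P + f.c0) =
      b.lam f 0 * ((H.getD b.i1 LinForm.zero).cx * x + (H.getD b.i1 LinForm.zero).cn * n +
          (H.getD b.i1 LinForm.zero).cp * p + (H.getD b.i1 LinForm.zero).cP * P + (H.getD b.i1 LinForm.zero).c0) +
      b.lam f 1 * ((H.getD b.i2 LinForm.zero).cx * x + (H.getD b.i2 LinForm.zero).cn * n +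
          (H.getD b.i2 LinForm.zero).cp * p + (H.getD b.i2 LinForm.zero).cP * P + (H.getD b.i2 LinForm.zero).c0) +
      b.lam f 2 * ((H.getD b.i3 LinForm.zero).cx * x + (H.getD b.i3 LinForm.zero).cn * n +
          (H.getD b.i3 LinForm.zero).cp * p + (H.getD b.i3 LinForm.zero).cP * P + (H.getD b.i3 LinForm.zero).c0) +
      b.lam f 3 * ((H.getD b.i4 LinForm.zero).cx * x + (H.getD b.i4 LinForm.zero).cn * n +
          (H.getD b.i4 LinForm.zero).cp * p + (H.getD b.i4 LinForm.zero).cP * P + (H.getD b.i4 LinForm.zero).c0) +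
      (b.d * f.c0 - (b.lam f 0 * (H.getD b.i1 LinForm.zero).c0 + b.lam f 1 * (H.getD b.i2 LinForm.zero).c0 +
          b.lam f 2 * (H.getD b.i3 LinForm.zero).c0 + b.lam f 3 * (H.getD b.i4 LinForm.zero).c0)) := by
    linear_combination x * ex + n * en + p * ep + P * eP
  have prod : 0 ≤ b.d * (f.cx * x + f.cn * n + f.cp * p + f.cP * P + f.c0) := by
    rw [key]
    have t1 := mul_nonneg l1 g1
    have t2 := mul_nonneg l2 g2
    have t3 := mul_nonneg l3 g3
    have t4 := mul_nonneg l4 g4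
    linarith
  nlinarith [prod, hd]

/-- **One obligation**: some basis of the slot certifies the gcd-relaxed conclusion. -/
def oblOK (H : List LinForm) (bases : List Basis) (f : LinForm) : Bool :=
  bases.any fun b => farkasCheck H b f.grelax

/-- Soundness of `oblOK` on integer points. -/
theorem oblOK_sound {H : List LinForm} {bases : List Basis} {f : LinForm} (hc : oblOK H bases f = true)
    {x n p P : ℤ} (hH : ∀ h ∈ H, 0 ≤ h.eval x n p P) : 0 ≤ f.eval x n p P := by
  unfold oblOK at hc
  obtain ⟨b, _, hb⟩ := List.any_eq_true.mp hc
  exact LinForm.eval_nonneg_of_grelax (farkasCheck_sound hb hH)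

/-- All obligations of a list. -/
def oblsOK (H : List LinForm) (bases : List Basis) (fs : List LinForm) : Bool := fs.all (oblOK H bases)

/-- Soundness of `oblsOK`: every listed conclusion holds. -/
theorem oblsOK_sound {H : List LinForm} {bases : List Basis} {fs : List LinForm} (hc : oblsOK H bases fs = true)
    {x n p P : ℤ} (hH : ∀ h ∈ H, 0 ≤ h.eval x n p P) : ∀ f ∈ fs, 0 ≤ f.eval x n p P := by
  intro f hf
  exact oblOK_sound ((List.all_eq_true.mp hc) f hf) hH

/-- REFINED HYPOTHESES: parity substitution then gcd-tightening, applied to a raw hypothesis list. -/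
def refine (a : ℤ) (H : List LinForm) : List LinForm := H.map fun h => (h.psub a).gtight

/-- The refined list holds at `(x, n', p', P)` when the raw list holds at `(x, 2n' + a, 2p' + 1, P)`. -/
theorem refine_holds {a : ℤ} {H : List LinForm} {x n' p' P : ℤ} (hH : ∀ h ∈ H, 0 ≤ h.eval x (2 * n' + a) (2 * p' + 1) P) :
    ∀ h ∈ refine a H, 0 ≤ h.eval x n' p' P := by
  intro h hh
  obtain ⟨g, hg, rfl⟩ := List.mem_map.mp hh
  exact LinForm.eval_gtight_nonneg (by rw [LinForm.eval_psub]; exact hH g hg)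

/-- **Main interface of this file.** `implOK a H bases fs`: after refinement, every conclusion in `fs` (parity-substituted)
is certified. -/
def implOK (a : ℤ) (H : List LinForm) (bases : List Basis) (fs : List LinForm) : Bool :=
  oblsOK (refine a H) bases (fs.map fun f => f.psub a)

/-- Soundness of `implOK` at integer points of the given parities: raw hypotheses in, raw conclusions out. -/
theorem implOK_sound {a : ℤ} {H : List LinForm} {bases : List Basis} {fs : List LinForm} (hc : implOK a H bases fs = true)
    {x n p P n' p' : ℤ} (hn : n = 2 * n' + a) (hp : p = 2 * p' + 1) (hH : ∀ h ∈ H, 0 ≤ h.eval x n p P) :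
    ∀ f ∈ fs, 0 ≤ f.eval x n p P := by
  intro f hf
  subst hn; subst hp
  have := oblsOK_sound hc (refine_holds hH) (f.psub a) (List.mem_map.mpr ⟨f, hf, rfl⟩)
  rwa [LinForm.eval_psub] at this


/-- `implOK` with the bases given by hypothesis-index quadruples (multipliers computed by `mkBasis` on the REFINED list). -/
def implOKq (a : ℤ) (H : List LinForm) (quads : List (ℕ × ℕ × ℕ × ℕ)) (fs : List LinForm) : Bool :=
  let Hr := refine a H
  oblsOK Hr (quads.map (mkBasis Hr)) (fs.map fun f => f.psub a)

/-- Soundness of `implOKq` (it is `implOK` with particular bases). -/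
theorem implOKq_sound {a : ℤ} {H : List LinForm} {quads : List (ℕ × ℕ × ℕ × ℕ)} {fs : List LinForm}
    (hc : implOKq a H quads fs = true) {x n p P n' p' : ℤ} (hn : n = 2 * n' + a) (hp : p = 2 * p' + 1)
    (hH : ∀ h ∈ H, 0 ≤ h.eval x n p P) : ∀ f ∈ fs, 0 ≤ f.eval x n p P :=
  implOK_sound (bases := quads.map (mkBasis (refine a H))) hc hn hp hH

end Summit.KontsevichZagierPeriods.Zeta5Search.CellKit
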